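import Literature.NumberTheory.GaloisRepresentations.LubinTateColemanCoordCoinvariantTwistTwo
import Literature.NumberTheory.GaloisRepresentations.PowerSeriesTopNilpotentEvalShift
import HarnessLib

/-!
# De Shalit II §4.12 ON THE SERIES SIDE at one prime (`q = 2`): from the cocycle `σ_{v c}(x a) + N a·x c = σ_{v a}(x c) + N c·x a` in the Coleman
# coordinate module and two auxiliary indices, **∃! `L_ε ∈ Λ = 𝒪_E⟦T⟧` with `φ_ε(x c) = (t_{v c} − N c)·L_ε` for every `c`**, `φ_ε(span x) = L_ε·J_ε`,
# and the weight values `(v_c^{k+1} − N_c(a_k))·L_ε(a_k)·mom_k(1) = mom_k(x c)` — the measure `μ(𝔣)` of the elliptic units, `ε`-part, in `Λ`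

De Shalit, *Iwasawa theory of elliptic curves with complex multiplication* (1987), II §4.12 (29)–(33) and III §1.4 (5): from the elliptic units
`e(𝔞)` with II §2.4 (ii) `e(𝔞)^{σ_𝔠 − N𝔠} = e(𝔠)^{σ_𝔞 − N𝔞}`, the measures `μ_𝔞 = i(e(𝔞))` satisfy `μ_𝔞(σ_𝔠 − N𝔠) = μ_𝔠(σ_𝔞 − N𝔞)`; choosing `𝔞₁`
with `σ_{𝔞₁}` a topological generator and `𝔞₂` making `(σ_{𝔞₁} − N𝔞₁, σ_{𝔞₂} − N𝔞₂)` relatively prime, `μ(𝔣) := μ_{𝔞₁}/(σ_{𝔞₁} − N𝔞₁)` is INTEGRAL,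
`μ_𝔠 = (σ_𝔠 − N𝔠)μ(𝔣)` for all `𝔠` (32)–(33), `i(𝒞_𝔣) = μ(𝔣)Λ₀` (III §1.4 (5)), and `∫ κ^k dμ(𝔣) = (κ(σ_𝔠)^k − N𝔠)⁻¹ ∫ κ^k dμ_𝔠` (31).  The measure
lane did this with distributions on the Galois group (`exists_twisting_μ_eq_forall_seriesFamily`).  THIS file does it in the SERIES currency of the
Coleman lane, on the `ε`-part `φ_ε : M → Λ` (`LubinTateColemanCoordCoinvariant{s,Twist}Two`: every `σ_v` is the scalar `t_v = φ_ε(σ_v 1)`, `t_γ = 1 + T`)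
with the elementary division by `T − b` of `PowerSeriesTopNilpotentEvalShift` (any `(π)`-adically complete base `S` — the one-level `𝒪_E` AND the
two-variable `𝒪_F⟦X⟧`) — everything PROVED (0 sorry, no definitions, no named facts):

* §1 the auxiliary index `a₁` with `v a₁ = γ` (THE module generator — chosen as `χ_π(σ_{𝔞₁})`) and `N a₁ = C n₁`, `n₁ ≡ 1 (mod π)` (an odd norm):
  `colemanDeltaCoinvFun_unitTwistₗ_self_one_sub_C` (**`t_γ − C n₁ = T − C(n₁ − 1)`**, a linear distinguished polynomial); the auxiliary `a₂`
  with `v a₂ = γ^m`, `N a₂ = C n₂`: `tEval_colemanDeltaCoinvFun_unitTwistₗ_pow_one_sub_C` (**`(t_{γ^m} − C n₂)(n₁ − 1) = n₁^m − n₂`**) — so "relatively prime" is `n₂ ≠ n₁^m`;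
* §2 ★★★ **`existsUnique_colemanDeltaCoinvFun_eq_mul`** — under the cocycle relation, `v a₁ = γ`, `N a₁ = C n₁` (`n₁ − 1 ∈ (π)`) and ONE index `a₂`
  with `(t_{v a₂} − N a₂)(n₁ − 1)` a non-zero-divisor of `S` (`≠ 0` in a domain: `…_of_ne_zero`): **there is a UNIQUE `L ∈ Λ = S⟦T⟧` with
  `φ_ε(x c) = (t_{v c} − N c)·L` for every `c`** — over ANY base `S` of the Coleman module;
* §3 consequences for that `L` (generic `S`): `colemanDeltaCoinvFun_map_span_range_eq_span_mul_of_forall` (**`φ_ε(Λ·span{x c}) = span{(t_{v c} − N c)·L}`** = `L·J_ε`, III §1.4 (5)),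
  and (§4, `S = 𝒪_E`) ★★ `tEval_mul_coordMoment_one_eq_of_forall_eq_mul` (**`(v_c^{k+1} − (N c)(a_k))·L(a_k)·mom_k(1) = mom_k(x c)`** for every `c` and every `k` with `(−1)^{k+1} = ε` — (31): the values
  of `L` at the weights are the moments (Coates–Wiles values) of the family divided by the Euler-type factors `κ^{k+1}(σ_𝔠) − N𝔠`).

For `x c = Col(e(𝔠))` (`ofPS (r_{e(𝔠)})`, the measure lane's `EllipticUnitsLocalTower` units read through `relUnitCoordTwo`, relation II §2.4 (ii) via
`relUnitCoordTwo_galAct`/`_mul`), `L` is de Shalit's `μ(𝔣)` on the `ε`-part of one prime, as a POWER SERIES; its weight values are `L`-values by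
the moment-identification chain (`coordMoment_relUnitCoordTwo_eq_coatesWiles` + cf2c-w4 and cf2-p1-w2 MI files).  Cell `bsd-print-cf2`, width seat `bsd-line-cf2c-w7` g13.

## References
* E. de Shalit, *Iwasawa theory of elliptic curves with complex multiplication* (1987), Ch. II §2.4 (ii), §4.12 (29)–(33); Ch. III §1.4 (5), §1.10 (17).
  [deShalit1987]
* L. C. Washington, *Introduction to Cyclotomic Fields*, 2nd ed. (1997), §7.1. [Washington1997]
-/

noncomputable section

open PowerSeries

namespace Literature.NumberTheory.GaloisRepresentations

section CoinvariantDivisionGeneric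

open GaloisRepresentations.IsNonarchimedeanLocalField LubinTate ValuativeRel

variable {F : Type} [Field F] [ValuativeRel F] [TopologicalSpace F] [IsNonarchimedeanLocalField F]

attribute [local instance] ltNormUniformSpace ltNormIsUniformAddGroup rk1 nF nE fintypeResidueField

variable {π : 𝒪[F]} (hπ : (valuation F).IsUniformizer (π : F)) (hq : residueFieldCard F = 2)
variable {S : Type*} [CommRing S] (ι : LTCoeff F →+* S) [IsAdicComplete (Ideal.span {ι (LTCoeff.of F π)}) S]
variable (u : (LTCoeff F)ˣ) (hu : LTCoeff.of F π = residueFieldCard F * u) (γ : 𝒪[F]ˣ)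
variable (hreg : ∀ x : S, ι (LTCoeff.of F π) * x = 0 → x = 0) (w : 𝒪[F]ˣ) (hγ : (γ : 𝒪[F]) = 1 + π ^ 2 * w)
variable (ε : PowerSeries S) (hε : ε * ε = 1)

/-! ### §1. The auxiliary indices in series currency (any base `S`) -/

/-- **`t_γ − C n = T − C(n − 1)`**: on the index with `v = γ` the cocycle denominator is a LINEAR distinguished polynomial (`t_γ = 1 + T`).
[cite: deShalit1987, Ch. II §4.12 (32)] -/
theorem colemanDeltaCoinvFun_unitTwistₗ_self_one_sub_C (n : S) :
    colemanDeltaCoinvFun hπ hq ι u hu γ hreg w hγ ε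
        (unitTwistₗ hπ hq ι u hu γ γ (TActModule.ofPS _ _ 1)) - PowerSeries.C n =
      1 * (PowerSeries.X - PowerSeries.C (n - 1)) := by
  rw [colemanDeltaCoinvFun_unitTwistₗ_self_one, one_mul, map_sub, map_one]
  ring

/-- **`(t_{γ^m} − C n₂)(b) = (1 + b)^m − n₂`** for any `b ∈ (π)` (`t_{γ^m} = (1+T)^m`); at `b = n₁ − 1`: `= n₁^m − n₂`, so the "relative primality" of
de Shalit's pair `(𝔞₁, 𝔞₂)` is `n₂ ≠ n₁^m`. [cite: deShalit1987, Ch. II §4.12 (29)] -/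
theorem tEval_colemanDeltaCoinvFun_unitTwistₗ_pow_one_sub_C {b : S} (hb : b ∈ Ideal.span {ι (LTCoeff.of F π)}) (m : ℕ)
    (n₂ : S) :
    tEval hb (colemanDeltaCoinvFun hπ hq ι u hu γ hreg w hγ ε
        (unitTwistₗ hπ hq ι u hu γ (γ ^ m) (TActModule.ofPS _ _ 1)) - PowerSeries.C n₂) =
      (1 + b) ^ m - n₂ := by
  rw [colemanDeltaCoinvFun_unitTwistₗ_pow_one, ← tEvalHom_apply, map_sub, tEvalHom_apply, tEvalHom_apply, tEval_one_add_X_pow, tEval_C]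

/-- At `b = n₁ − 1`: `(t_{γ^m} − C n₂)(n₁ − 1) = n₁^m − n₂`. [cite: deShalit1987, Ch. II §4.12 (29)] -/
theorem tEval_colemanDeltaCoinvFun_unitTwistₗ_pow_one_sub_C_sub_one {n₁ : S} (hb : n₁ - 1 ∈ Ideal.span {ι (LTCoeff.of F π)})
    (m : ℕ) (n₂ : S) :
    tEval hb (colemanDeltaCoinvFun hπ hq ι u hu γ hreg w hγ ε
        (unitTwistₗ hπ hq ι u hu γ (γ ^ m) (TActModule.ofPS _ _ 1)) - PowerSeries.C n₂) =
      n₁ ^ m - n₂ := by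
  rw [tEval_colemanDeltaCoinvFun_unitTwistₗ_pow_one_sub_C, add_sub_cancel]

/-! ### §2. Existence and uniqueness of the divided element `L = μ(𝔣)_ε` -/

include hε in
/-- ★★★ **DE SHALIT II §4.12 ON THE SERIES SIDE** (`ε`-part, one prime, `q = 2`): let `x : I → M` satisfy the cocycle relation
`σ_{v c}(x a) + N a • x c = σ_{v a}(x c) + N c • x a` (II §2.4 (ii)), let `a₁` have `v a₁ = γ` and `N a₁ = C n₁` with `n₁ ≡ 1 (mod π)`, and let `a₂`
have `(t_{v a₂} − N a₂)(n₁ − 1)` a non-zero-divisor of `S`.  Then **there is a UNIQUE `L ∈ Λ = S⟦T⟧` with `φ_ε(x c) = (t_{v c} − N c)·L` for EVERY `c`**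
(any base `S` of the Coleman module — `𝒪_E` at one level, `𝒪_F⟦X⟧` for the two-variable tower).
[cite: deShalit1987, Ch. II §4.12 (29)–(33)] -/
theorem existsUnique_colemanDeltaCoinvFun_eq_mul {I : Type*} (x : I → ColemanCoordModule hπ hq ι u hu γ)
    (v : I → 𝒪[F]ˣ) (N : I → PowerSeries S)
    (hrel : ∀ a c : I, unitTwistₗ hπ hq ι u hu γ (v c) (x a) + N a • x c =
      unitTwistₗ hπ hq ι u hu γ (v a) (x c) + N c • x a)
    (a₁ a₂ : I) (hv₁ : v a₁ = γ) {n₁ : S} (hN₁ : N a₁ = PowerSeries.C n₁)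
    (hn₁ : n₁ - 1 ∈ Ideal.span {ι (LTCoeff.of F π)})
    (ha₂ : tEval hn₁ (colemanDeltaCoinvFun hπ hq ι u hu γ hreg w hγ ε
        (unitTwistₗ hπ hq ι u hu γ (v a₂) (TActModule.ofPS _ _ 1)) - N a₂) ∈ nonZeroDivisors S) :
    ∃! L : PowerSeries S, ∀ c : I,
      colemanDeltaCoinvFun hπ hq ι u hu γ hreg w hγ ε (x c) =
        (colemanDeltaCoinvFun hπ hq ι u hu γ hreg w hγ ε
          (unitTwistₗ hπ hq ι u hu γ (v c) (TActModule.ofPS _ _ 1)) - N c) * L := by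
  -- the denominator at `a₁` is `1 · (T − C(n₁ − 1))`
  have hd₁ : colemanDeltaCoinvFun hπ hq ι u hu γ hreg w hγ ε
        (unitTwistₗ hπ hq ι u hu γ (v a₁) (TActModule.ofPS _ _ 1)) - N a₁ =
      1 * (PowerSeries.X - PowerSeries.C (n₁ - 1)) := by
    rw [hv₁, hN₁]; exact colemanDeltaCoinvFun_unitTwistₗ_self_one_sub_C hπ hq ι u hu γ hreg w hγ ε n₁
  have hreg₁ := mem_nonZeroDivisors_of_eq_unit_mul_X_sub_C' hn₁ isUnit_one hd₁
  -- the cocycle at `(a₁, a₂)`: `(t₂ − N₂)·φ(x₁) = (t₁ − N₁)·φ(x₂)`, and division by `T − b`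
  have hcoc := colemanDeltaCoinvFun_cocycle hπ hq ι u hu γ hreg w hγ ε hε x v N hrel a₁ a₂
  obtain ⟨L, hL⟩ := exists_eq_mul_of_mul_eq_mul' hn₁ isUnit_one hd₁ hcoc ha₂
  refine ⟨L, fun c => colemanDeltaCoinvFun_eq_mul_of_divides hπ hq ι u hu γ hreg w hγ ε hε x v N hrel a₁ L
    hreg₁ hL c, fun L' hL' => ?_⟩
  exact (mul_cancel_left_mem_nonZeroDivisors hreg₁).mp ((hL' a₁).symm.trans hL)

include hε in
/-- **Domain form**: in a domain `S` the auxiliary condition is `(t_{v a₂} − N a₂)(n₁ − 1) ≠ 0` — for `v a₂ = γ^m`, `N a₂ = C n₂`: `n₁^m ≠ n₂`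
(`tEval_colemanDeltaCoinvFun_unitTwistₗ_pow_one_sub_C_sub_one`). [cite: deShalit1987, Ch. II §4.12 (29)–(33)] -/
theorem existsUnique_colemanDeltaCoinvFun_eq_mul_of_ne_zero [IsDomain S] {I : Type*} (x : I → ColemanCoordModule hπ hq ι u hu γ)
    (v : I → 𝒪[F]ˣ) (N : I → PowerSeries S)
    (hrel : ∀ a c : I, unitTwistₗ hπ hq ι u hu γ (v c) (x a) + N a • x c =
      unitTwistₗ hπ hq ι u hu γ (v a) (x c) + N c • x a)
    (a₁ a₂ : I) (hv₁ : v a₁ = γ) {n₁ : S} (hN₁ : N a₁ = PowerSeries.C n₁)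
    (hn₁ : n₁ - 1 ∈ Ideal.span {ι (LTCoeff.of F π)})
    (ha₂ : tEval hn₁ (colemanDeltaCoinvFun hπ hq ι u hu γ hreg w hγ ε
        (unitTwistₗ hπ hq ι u hu γ (v a₂) (TActModule.ofPS _ _ 1)) - N a₂) ≠ 0) :
    ∃! L : PowerSeries S, ∀ c : I,
      colemanDeltaCoinvFun hπ hq ι u hu γ hreg w hγ ε (x c) =
        (colemanDeltaCoinvFun hπ hq ι u hu γ hreg w hγ ε
          (unitTwistₗ hπ hq ι u hu γ (v c) (TActModule.ofPS _ _ 1)) - N c) * L :=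
  existsUnique_colemanDeltaCoinvFun_eq_mul hπ hq ι u hu γ hreg w hγ ε hε x v N hrel a₁ a₂ hv₁ hN₁ hn₁ (mem_nonZeroDivisors_of_ne_zero ha₂)

/-! ### §3. Consequences for the divided element -/

/-- ★ **`φ_ε(span{x c}) = span{(t_{v c} − N c)·L}`** (`= L·J_ε`): de Shalit III §1.4 (5) `i(𝒞_𝔣) = μ(𝔣)·Λ₀` on the `ε`-part, series side, for the
`L` of `existsUnique_colemanDeltaCoinvFun_eq_mul` (any `L` with the displayed property). [cite: deShalit1987, Ch. III §1.4 (5); Ch. II §4.12 (33)] -/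
theorem colemanDeltaCoinvFun_map_span_range_eq_span_mul_of_forall {I : Type*} (x : I → ColemanCoordModule hπ hq ι u hu γ)
    (v : I → 𝒪[F]ˣ) (N : I → PowerSeries S) (L : PowerSeries S)
    (hL : ∀ c : I, colemanDeltaCoinvFun hπ hq ι u hu γ hreg w hγ ε (x c) =
      (colemanDeltaCoinvFun hπ hq ι u hu γ hreg w hγ ε
        (unitTwistₗ hπ hq ι u hu γ (v c) (TActModule.ofPS _ _ 1)) - N c) * L) :
    (Submodule.span (PowerSeries S) (Set.range x)).map (colemanDeltaCoinvFun hπ hq ι u hu γ hreg w hγ ε) =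
      Ideal.span (Set.range fun c => (colemanDeltaCoinvFun hπ hq ι u hu γ hreg w hγ ε
        (unitTwistₗ hπ hq ι u hu γ (v c) (TActModule.ofPS _ _ 1)) - N c) * L) := by
  have hfun : (⇑(colemanDeltaCoinvFun hπ hq ι u hu γ hreg w hγ ε) ∘ x) = fun c =>
      (colemanDeltaCoinvFun hπ hq ι u hu γ hreg w hγ ε
        (unitTwistₗ hπ hq ι u hu γ (v c) (TActModule.ofPS _ _ 1)) - N c) * L := funext hL
  rw [Submodule.map_span, ← Set.range_comp, hfun]

/-- The ideal `φ_ε(span{x c})` is contained in the principal ideal `(L)`. [cite: deShalit1987, Ch. III §1.4 (5)] -/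
theorem colemanDeltaCoinvFun_map_span_range_le_span_singleton {I : Type*} (x : I → ColemanCoordModule hπ hq ι u hu γ)
    (v : I → 𝒪[F]ˣ) (N : I → PowerSeries S) (L : PowerSeries S)
    (hL : ∀ c : I, colemanDeltaCoinvFun hπ hq ι u hu γ hreg w hγ ε (x c) =
      (colemanDeltaCoinvFun hπ hq ι u hu γ hreg w hγ ε
        (unitTwistₗ hπ hq ι u hu γ (v c) (TActModule.ofPS _ _ 1)) - N c) * L) :
    (Submodule.span (PowerSeries S) (Set.range x)).map (colemanDeltaCoinvFun hπ hq ι u hu γ hreg w hγ ε) ≤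
      Ideal.span {L} := by
  rw [colemanDeltaCoinvFun_map_span_range_eq_span_mul_of_forall hπ hq ι u hu γ hreg w hγ ε x v N L hL, Ideal.span_le]
  rintro _ ⟨c, rfl⟩
  exact Ideal.mem_span_singleton'.mpr ⟨_, rfl⟩

end CoinvariantDivisionGeneric

/-! ### §4. The weight values of the divided element (`S = 𝒪_E`) -/

section CoinvariantDivisionWeights

open GaloisRepresentations.IsNonarchimedeanLocalField LubinTate ValuativeRel Field

variable {F : Type} [Field F] [ValuativeRel F] [TopologicalSpace F] [IsNonarchimedeanLocalField F]

attribute [local instance] ltNormUniformSpace ltNormIsUniformAddGroup rk1 nF nE fintypeResidueField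

variable {π : 𝒪[F]} (hπ : (valuation F).IsUniformizer (π : F))
variable (E : IntermediateField F (AlgebraicClosure F)) [FiniteDimensional F E]
variable (hq : residueFieldCard F = 2) (u : (LTCoeff F)ˣ) (hu : LTCoeff.of F π = residueFieldCard F * u) (γ : 𝒪[F]ˣ)
variable [IsAdicComplete (Ideal.span {algebraMap (LTCoeff F) (unitBall E) (LTCoeff.of F π)}) (unitBall E)]
variable (hreg : ∀ x : unitBall E, algebraMap (LTCoeff F) (unitBall E) (LTCoeff.of F π) * x = 0 → x = 0)
  (w : 𝒪[F]ˣ) (hγ : (γ : 𝒪[F]) = 1 + π ^ 2 * w)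

include hu in
/-- ★★ **THE WEIGHT VALUES OF THE DIVIDED ELEMENT** (de Shalit II §4.12 (31) on the series side): for every `c` and every `k` with
`ε = (−1)^{k+1}`, **`(v_c^{k+1} − (N c)(a_k)) · L(a_k) · mom_k(1) = mom_k(x c)`** — `L`'s values at the weights of parity `ε` are the moments of the
family divided by the Euler-type factors. [cite: deShalit1987, Ch. II §4.12 (29)–(31)] -/
theorem tEval_mul_coordMoment_one_eq_of_forall_eq_mul {I : Type*} (x : I → ColemanCoordModule hπ hq (algebraMap (LTCoeff F) (unitBall E)) u hu γ)
    (v : I → 𝒪[F]ˣ) (N : I → PowerSeries (unitBall E)) (L : PowerSeries (unitBall E)) (k : ℕ)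
    (hL : ∀ c : I, colemanDeltaCoinvFun hπ hq (algebraMap (LTCoeff F) (unitBall E)) u hu γ hreg w hγ ((-1) ^ (k + 1)) (x c) =
      (colemanDeltaCoinvFun hπ hq (algebraMap (LTCoeff F) (unitBall E)) u hu γ hreg w hγ ((-1) ^ (k + 1))
        (unitTwistₗ hπ hq (algebraMap (LTCoeff F) (unitBall E)) u hu γ (v c) (TActModule.ofPS _ _ 1)) - N c) * L) (c : I) :
    (algebraMap 𝒪[F] (unitBall E) (v c : 𝒪[F]) ^ (k + 1) - tEval (algebraMap_unit_pow_sub_one_mem hπ E hq γ k) (N c)) *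
        tEval (algebraMap_unit_pow_sub_one_mem hπ E hq γ k) L * coordMoment hπ E u k 1 =
      coordMoment hπ E u k (TActModule.toPS (x c)) :=
  tEval_mul_coordMoment_one_eq_of_eq_mul hπ E hq u hu γ hreg w hγ k (v c) (N c) L (x c) (hL c)

end CoinvariantDivisionWeights

end Literature.NumberTheory.GaloisRepresentations
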